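import Summits.BirchSwinnertonDyer.BirchSwinnertonDyer.Theorems.PrintCf2SplitBadTwoQuadraticSignCharacter
import Literature.NumberTheory.GaloisRepresentations.ArtinRestriction
import Literature.NumberTheory.GaloisRepresentations.DecompositionGroupOfCompletion
import Literature.NumberTheory.GaloisRepresentations.IntegralGaloisActionProofs
import Literature.NumberTheory.EllipticCurves.GreenbergSelmer
import Summits.BirchSwinnertonDyer.BirchSwinnertonDyer.Theorems.PrintCf2SplitBadTwoKummerUProNullAssembly
import HarnessLib

/-!
# Crux `PrintCf2.SplitBadTwoRankOneOfFacts` (stmt-BirchSwinnertonDyer-20368), skeleton v13.5, registered stub `stub_xRegular_two` = (REG₂), FACT-FREE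
# road, θ-BOOKKEEPING glue: THE RAMIFICATION DICHOTOMY OF A QUADRATIC FRAMED CHARACTER — finitely many ramified places, and at each place
# `w` either every inertia element acts trivially on `A_θ` or the chosen inertia group `I_w` carries `ε = −1`

Cell `bsd-print-cf2`, EXTRA WIDTH seat `bsd-line-cf2-p1-w4` g14 (prover-bsd-line-cf2-p1-w4-g14-0); `--supports stmt-BirchSwinnertonDyer-20368`
(helper, Theses-free). HONEST FRAMING: nothing here closes the crux or a registered stub; BSD is not proved by any of this; no summit
statement is proved by this seat. No definition, no named fact, no `sorry`. Plumbing only.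

WHY. The θ-uniform level assembly of the (LSₙ,₂) socket (-w8 g5: B2c/B2d/B3c) needs, for the framed quadratic `θ` of the stub: (a) a FINITE set of bad
places `S ⊇ {2-adic} ∪ Ram(θ)` (B2c's `hS`), (b) at every `w ∉ {v, v̄}` the DICHOTOMY consumed by p705557
`KummerUDict.exists_level_resH1Hom_eq_zero_of_local_twisted_ramified`: either the level module is unramified at `w` (⟹ `isUnramifiedAt_coind`
⟹ B2d clause (ii) ⟹ `unramifiedKer`) or `∃ τ ∈ GreenbergSelmer.inertia w, ε τ ≠ 1` (⟹ the non-split valuation trick). THIS FILE: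
* `isOpen_ker_of_sq_eq_one` — `θ² = 1 ⟹ ker θ ⊆ Γ_K` is open (= `ker ε`, p706294);
* **`eventually_isUnramifiedAt_of_sq_eq_one`** / `finite_setOf_not_isUnramifiedAt_of_sq_eq_one` — `θ` is unramified at all but finitely many
  places (tree `FramedGaloisRep.eventually_isUnramifiedAt_of_isOpen_ker`);
* **`exists_mem_inertia_apply_ne_one_of_not_isUnramifiedAt`** — `¬ θ.IsUnramifiedAt w ⟹ ∃ τ ∈ GreenbergSelmer.inertia w, θ τ ≠ 1` (transport
  from any prime above `w` to the chosen one), `forall_inertia_apply_eq_one_of_isUnramifiedAt` (converse at the chosen prime);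
* **`isUnramifiedAt_or_exists_mem_inertia_sign_ne_one`** — with the sign `ε` of p706294 (`ε σ = 1 ↔ unitChar θ σ = 1`): for every `w`,
  `θ.IsUnramifiedAt w ∨ ∃ τ ∈ GreenbergSelmer.inertia w, ε τ ≠ 1`;
* **`smul_eq_self_of_isUnramifiedAt`** — `θ.IsUnramifiedAt w ⟹ ∀ 𝔓 ∣ w, ∀ τ ∈ I_𝔓, ∀ a ∈ A_θ, τ • a = a` (the input of `isUnramifiedAt_coind` for
  the level modules `A_θ[2^m]`, model-free).
presearch: none needed (plumbing); no new fact. beyond-print theorem: no.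

References: [SerreAbelianLadic1968] Ch. I §2.1; [NeukirchANT1999] Ch. I §9 (9.1), (9.4); [KellerYin2024] §1.1.
-/

noncomputable section

set_option linter.dupNamespace false
set_option autoImplicit false

open scoped Classical Pointwise
open NumberField IsDedekindDomain Field
open Literature.NumberTheory.GaloisRepresentations Literature.NumberTheory.EllipticCurves
open Literature.NumberTheory.EllipticCurves.KellerYin2024 Literature.NumberTheory.IwasawaTheory
open Summit.BirchSwinnertonDyer.BirchSwinnertonDyer.Theorems.PrintCf2

namespace Summit.BirchSwinnertonDyer.BirchSwinnertonDyer.Theorems.PrintCf2.KummerUDict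

variable {K : Type} [Field K]

/-- **`θ² = 1 ⟹ ker θ` is open** (it is the kernel of the sign character `ε`, p706294). [cite: KellerYin2024, §1.1] -/
theorem isOpen_ker_of_sq_eq_one (θ : FramedGaloisRep K (padicCoeffIntegers (∅ : Set (PadicAlgCl 2))) 1)
    (hθ : ∀ σ : absoluteGaloisGroup K, θ σ ^ 2 = 1) :
    IsOpen ((θ.toMonoidHom.ker : Subgroup (absoluteGaloisGroup K)) : Set (absoluteGaloisGroup K)) := by
  obtain ⟨ε, -, hiff, hopen, -⟩ := exists_signHom_of_sq_eq_one θ hθ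
  have hker : ((θ.toMonoidHom.ker : Subgroup (absoluteGaloisGroup K)) : Set (absoluteGaloisGroup K)) =
      ((ε.ker : Subgroup (absoluteGaloisGroup K)) : Set (absoluteGaloisGroup K)) := by
    ext σ
    simp only [SetLike.mem_coe, MonoidHom.mem_ker, ContinuousMonoidHom.coe_toMonoidHom]
    change θ σ = 1 ↔ ε σ = 1
    rw [← unitChar_eq_one_iff_apply_eq_one, hiff]
  rw [hker]
  exact hopen

variable [NumberField K]

/-- **A quadratic framed character is unramified at all but finitely many places.** [cite: SerreAbelianLadic1968, Ch. I §2.1] -/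
theorem eventually_isUnramifiedAt_of_sq_eq_one (θ : FramedGaloisRep K (padicCoeffIntegers (∅ : Set (PadicAlgCl 2))) 1)
    (hθ : ∀ σ : absoluteGaloisGroup K, θ σ ^ 2 = 1) :
    ∀ᶠ v in Filter.cofinite, θ.IsUnramifiedAt v :=
  FramedGaloisRep.eventually_isUnramifiedAt_of_isOpen_ker θ (isOpen_ker_of_sq_eq_one θ hθ)

/-- The set of places where a quadratic framed character ramifies is FINITE (B2c's finite `S`). [cite: SerreAbelianLadic1968, Ch. I §2.1] -/
theorem finite_setOf_not_isUnramifiedAt_of_sq_eq_one (θ : FramedGaloisRep K (padicCoeffIntegers (∅ : Set (PadicAlgCl 2))) 1)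
    (hθ : ∀ σ : absoluteGaloisGroup K, θ σ ^ 2 = 1) :
    {v : HeightOneSpectrum (𝓞 K) | ¬ θ.IsUnramifiedAt v}.Finite :=
  Filter.eventually_cofinite.mp (eventually_isUnramifiedAt_of_sq_eq_one θ hθ)

section AnyRank

variable {A : Type*} [CommRing A] [TopologicalSpace A] {n : ℕ}

/-- **Ramified ⟹ a non-trivial element in the CHOSEN inertia group.** If `θ` is not unramified at `w` then some `τ` in the tree's chosen inertia
group `GreenbergSelmer.inertia w` (= `I_{𝔓₀}`, `𝔓₀ = adicCompletionPrime K w`) has `θ τ ≠ 1` (transport the witness from any prime `𝔓 = g•𝔓₀`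
above `w` by `τ := g⁻¹σg`). [cite: NeukirchANT1999, Ch. I §9 (9.1), (9.4)] -/
theorem exists_mem_inertia_apply_ne_one_of_not_isUnramifiedAt (θ : FramedGaloisRep K A n) {w : HeightOneSpectrum (𝓞 K)}
    (h : ¬ θ.IsUnramifiedAt w) : ∃ τ ∈ GreenbergSelmer.inertia w, θ τ ≠ 1 := by
  simp only [FramedGaloisRep.IsUnramifiedAt, not_forall, exists_prop] at h
  obtain ⟨𝔓, h𝔓, σ, hσ, hne⟩ := h
  obtain ⟨g, hg⟩ := HeightOneSpectrum.exists_smul_eq_of_mem_primesAbove_holds (K := K) (v := w)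
    (adicCompletionPrime_mem_primesAbove K w) h𝔓
  have hI : GreenbergSelmer.inertia w = (adicCompletionPrime K w).inertia (absoluteGaloisGroup K) :=
    (inertia_adicCompletionPrime_eq_map_absInertia K w).symm
  refine ⟨g⁻¹ * σ * g, ?_, fun h1 ↦ hne ?_⟩
  · rw [hI, ← KummerU.mem_inertia_pointwise_smul_iff, hg]
    exact hσ
  · rw [map_mul, map_mul, map_inv] at h1
    have h2 : θ σ = θ g * ((θ g)⁻¹ * θ σ * θ g) * (θ g)⁻¹ := by group
    rw [h1, mul_one, mul_inv_cancel] at h2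
    exact h2

/-- At the chosen prime: `θ` unramified at `w` ⟹ `θ = 1` on `GreenbergSelmer.inertia w`. [cite: NeukirchANT1999, Ch. I §9 (9.4)] -/
theorem forall_inertia_apply_eq_one_of_isUnramifiedAt (θ : FramedGaloisRep K A n) {w : HeightOneSpectrum (𝓞 K)}
    (h : θ.IsUnramifiedAt w) : ∀ τ ∈ GreenbergSelmer.inertia w, θ τ = 1 := by
  intro τ hτ
  have hI : GreenbergSelmer.inertia w = (adicCompletionPrime K w).inertia (absoluteGaloisGroup K) :=
    (inertia_adicCompletionPrime_eq_map_absInertia K w).symm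
  rw [hI] at hτ
  exact h _ (adicCompletionPrime_mem_primesAbove K w) τ hτ

end AnyRank

/-- **THE DICHOTOMY with the sign character.** For `ε` with `ε σ = 1 ↔ unitChar θ σ = 1` (p706294 `exists_signHom_of_sq_eq_one`): at every
place `w`, either `θ` is unramified at `w` or some `τ` of the chosen inertia group has `ε τ ≠ 1` — the case split of p705557's hypothesis at
`w ∉ {v, v̄}`. [cite: NeukirchANT1999, Ch. I §9] -/
theorem isUnramifiedAt_or_exists_mem_inertia_sign_ne_one (θ : FramedGaloisRep K (padicCoeffIntegers (∅ : Set (PadicAlgCl 2))) 1)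
    {ε : absoluteGaloisGroup K →* ℤˣ} (hε : ∀ σ, ε σ = 1 ↔ unitChar θ σ = 1) (w : HeightOneSpectrum (𝓞 K)) :
    θ.IsUnramifiedAt w ∨ ∃ τ ∈ GreenbergSelmer.inertia w, ε τ ≠ 1 := by
  by_cases h : θ.IsUnramifiedAt w
  · exact Or.inl h
  · obtain ⟨τ, hτ, hne⟩ := exists_mem_inertia_apply_ne_one_of_not_isUnramifiedAt θ h
    exact Or.inr ⟨τ, hτ, fun h1 ↦ hne ((unitChar_eq_one_iff_apply_eq_one θ τ).1 ((hε τ).1 h1))⟩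

omit [NumberField K] in
/-- **Unramified ⟹ inertia acts trivially on `A_θ`**: for `θ² = 1` unramified at `w`, every `τ ∈ I_𝔓`, `𝔓 ∣ w`, fixes `A_θ = ℚ₂/ℤ₂(θ)`
pointwise — the input of `isUnramifiedAt_coind` for the (sub)modules of `A_θ`. [cite: KellerYin2024, §1.1] -/
theorem smul_eq_self_of_isUnramifiedAt (θ : FramedGaloisRep K (padicCoeffIntegers (∅ : Set (PadicAlgCl 2))) 1)
    (hθ : ∀ σ : absoluteGaloisGroup K, θ σ ^ 2 = 1) {w : HeightOneSpectrum (𝓞 K)} (h : θ.IsUnramifiedAt w)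
    {𝔓 : Ideal (absIntegers (𝓞 K) K)} (h𝔓 : 𝔓 ∈ w.primesAbove) {τ : absoluteGaloisGroup K}
    (hτ : τ ∈ 𝔓.inertia (absoluteGaloisGroup K)) (a : charModule (∅ : Set (PadicAlgCl 2)) θ) : τ • a = a := by
  obtain ⟨ε, -, hiff, -, hsmul⟩ := exists_signHom_of_sq_eq_one θ hθ
  have h1 : ε τ = 1 := (hiff τ).2 ((unitChar_eq_one_iff_apply_eq_one θ τ).2 (h 𝔓 h𝔓 τ hτ))
  rw [hsmul, h1, Units.val_one, one_smul]

end Summit.BirchSwinnertonDyer.BirchSwinnertonDyer.Theorems.PrintCf2.KummerUDict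

end
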